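import Literature.MathematicalPhysics.QuantumFieldTheory.Balaban1983to89.B6Prop26MirrorAssemblyV1
import Literature.MathematicalPhysics.QuantumFieldTheory.Balaban1983to89.B6Line3CubeTransposeV1
import Literature.MathematicalPhysics.QuantumFieldTheory.Balaban1983to89.B6Ineq2140KLevelV1
import Literature.MathematicalPhysics.QuantumFieldTheory.Balaban1983to89.B6GDVaLegKLevelV1

/-!
# `Balaban1983to89.B6Prop26DivLegKLevelV1` — T. Bałaban, *Propagators and renormalization transformations for lattice gauge theories. II*,
# Commun. Math. Phys. **96** (1984) 223–250 [Balaban1984PropagatorsII], Prop. 2.6 (2.136) p. 247, THE THIRD ENTRY `|(G∇*J)(x)| ≤ O(1)L^jη e^{−δ₃d}|J|`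
# AT k LEVELS FOR THE GENUINE `G`: line 3ᵀ discharged, the level-gap transport of the prefactor to the output block, and (2.136)₃ from its first legs

statement-level skeleton of published theorems with citation tags; proofs where landed; nothing here is a claim about the Yang–Mills mass gap

PDF held: `paper:balaban1984-cmp96-propagators-rt-ii` (journal page = PDF page + 222); p. 247 [PDF 25] ((2.136), (2.141)) re-read this generation on the ×2 render
`b2b-balaban-ref1/pages/1984-cmp96-propagators-rt-II/1984-cmp96-propagators-rt-II-p025-x2.png`.

CITATION HEADER (lean-in-tree rule) — WHAT IS REPRODUCED.  Phase-2 file of the `lit-balaban` typed skeleton (HOME `run/shared/lean/pub/lit-balaban/`), seat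
**p38 gen 31**, brick 7 of the programme «(2.136)₃ by the transposed walk»; SKELETON row B6.Prop2.6 (cells; decl of record untouched).  Print p. 247:
«|(G∇*J)(x)| … ≤ O(1)L^jη e^{−δ₃d(y,y′)}|J| for x ∈ B^j(y), J ∈ A(B(y′))».
* §1 **`prop26_2136T_kLevel_line3_le`** — p38's `prop26_2136T_kLevel_final_le` (`…B6Prop26MirrorAssemblyV1`) with line 3ᵀ DISCHARGED by p22's
  `B6Line3CubeTransposeV1.line3_cube_transpose` (consumed at `σ ≤ min σ₀ (ρ₃/2)`): for ANY right factor `D′` and input weight `P ≥ 0`, the displayed first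
  legs `h_□G_□h_□D′ ≤ 1_{Q_□}(y)·C_L·e^{−2σd}·P(y′)` give `HasMajorant (G·D′) (A·e^{−(1−α)σd(y,y′)}·P(y′))` above one threshold;
* §2 **`len_le_of_levelGap`** (`L^{j(y′)} ≤ L·e^{(τ/2)d_T(y,y′)}·L^{j(y)}` when `2 log L ≤ τ(R·L·M_h − 1)`, from p22's `powL_sq_le_of_levelGap`) and
  **`hasMajorant_len_transport`** (an input-block prefactor `L^{j(y′)}` becomes the output-block prefactor `L^{j(y)}` at the cost `L·e^{(τ/2)d}`);
* §2′ **`hasMajorant_len_transport_in`** (output-block prefactor ↦ input-block prefactor, the form the left chain consumes);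
* §3 **`prop26_2136_div_kLevel_le`** — (2.136)₃ for the genuine `G`: with `D′ = ∇^{η*}_ν = c′(S_ν⁻¹ − 1)` (`B6LapLegKLevelV1.DVa`) and the displayed first legs
  `h_□G_□h_□∇* ≤ 1_{Q_□}(y)·C_L·e^{−2σd}·L^{j(y′)}/|c′|` (p22's `hGDVa0_cube` shape), `HasMajorant (G∇*_ν) (A·L·(L^{j(y)}/|c′|)·e^{−((1−α)σ − τ/2)d(y,y′)})` —
  print's `O(1)L^jη e^{−δ₃d}` (`η = |c′|⁻¹`); **`prop26_2136_div_kLevel_of_outLeg`** — the same from first legs in the OUTPUT-prefactor form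
  `1_{Q_□}(y)·C_L·(L^{j(y)}/|c′|)·e^{−ρ_L d}` (gen-30's `hDG0_cube` shape transposed);
* §4 **`prop26_2136_div_kLevel`** — (2.136)₃ WITH NO DISPLAYED LEG: the first legs discharged by p38's `B6GDVaLegKLevelV1.hGDVa0_cube`; the remaining
  hypotheses are torus-size thresholds, the Lemma-2.1 budget and the transport condition `2 log L ≤ τ(R·L·M_h − 1)` only; the transport budget
  `τ ∈ [0, 2σ]` is bound AFTER `σ` (p22 g24's consumer remark), so `τ := (1−α)σ` yields the manifestly positive rate `(1−α)σ/2`.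
* §5 (gen 34) **`prop26_2136_div_kLevel_census`** — (2.136)₃ IN THE CENSUS SHAPE the k-level census of `B6.Prop26Printed` consumes (fold owner
  r03 g26, seat INBOX 2026-08-24T08:07Z): `∃ δ A M₂ N₁, 0 < δ ∧ 0 ≤ A ∧ 0 < M₂ ∧ ∀ (admissible torus, M₂ ≤ L·M_h, N₁ + 1 ≤ R·L·M_h) (c′ ≠ 0) (band) ν,
  HasMajorant (G ∘ ∇^{η*}_ν) (A·(L^{j(y)}|c′|⁻¹)·e^{−δ d_T(y,y′)})` — §4 instantiated at `σ := σ₀`, Lemma-2.1 exponent `½`, `τ := σ₀/2` (rate `σ₀/4`), the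
  two side conditions discharged from `N₁` (private `budget_lt_one`, `transport_of_le`).
All theorems, proved, 0 sorry, no new `def … : Prop`; standard axioms.

HONEST SCOPE / DIVERGENCES.  (1) In §1–§3 the first legs `h_□G_□h_□∇*` are displayed; §4 discharges them (`B6GDVaLegKLevelV1`).  (2) The transport costs a rate `τ/2` and the torus-size condition `2 log L ≤ τ(R·L·M_h − 1)` (p22's (2.140) convention); print's `δ₃` is not
quantified.  (3) As in bricks 1–6: `L ≥ 5`, `M_h = L^a ≥ 8`, every cube placed, global band; constants on `d, L, b₀, b₁, C_L` only.  Nothing on d = 4 or the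
continuum; NOT summit progress.  Unit `lit-balaban-p38` (gen 31), 2026-08-23; §5 added gen 34, 2026-08-24 (the gen-31 text p372746 never entered the tree — bounced on the F12 olean race —
so this is the first tree version: §§1–4 = p372746 verbatim, + §5).
-/

noncomputable section

open scoped BigOperators
open Finset

namespace Literature.MathematicalPhysics.QuantumFieldTheory.Balaban1983to89.B6Prop26DivLegKLevelV1

open B6MultiLevelBoxOperator (N0)
open B6MultiLevelTorusOperator (TDomains)
open B6Cover236MultiLevelBlocks (cubes)
open B6Geom246MultiLevelBox (bset)
open B6Geom246MultiLevelTorus (geomT)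
open B8Ineq192MultiLevelTorus (geomTB geomTB_len geomTB_M symmT)
open B6RandomWalk (HasMajorant hasMajorant_mono)
open B6Prop26Gluing (mulOp ind)
open B6Ineq2133TwoScaleV1 (onFun)
open B6GlobalChartV1 (PV domT blkV1)
open B6SectAOperatorsV1 (dE dsE RE BondIdx)
open B6SectAVectorModelV1 (GE)
open B6Partition118KLevelTorusCentral (one_le_of_four_le)
open B6Prop26KLevelSkeletonV1 (hB zB ST)
open B6CubeWindowV1 (Placed Gl Pl GlobalBand band_le one_le_of_eight_le four_le_of_five_le)
open B6Prop26KLevelAssemblyV1 (lenTB_pos distT_nonneg)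
open B6Prop26MirrorAssemblyV1 (prop26_2136T_kLevel_final_le)
open B6Line3CubeTransposeV1 (line3_cube_transpose)
open B6Ineq2140KLevelV1 (powL_sq_le_of_levelGap)
open B6LapLegKLevelV1 (DVa)
open B6GDVaLegKLevelV1 (hGDVa0_cube)

variable {d ℓ : ℕ} {hd : 1 ≤ d + 1} {hL : Odd (ℓ + 1) ∧ 1 < ℓ + 1} {m K : ℕ} {Mh k R : ℕ} {P' : Fin (d + 1) → ℕ}

/-- rate weakening of an exponential kernel. [folklore] -/
private theorem exp_le_exp_of_rate {ρ σ t : ℝ} (h : σ ≤ ρ) (ht : 0 ≤ t) : Real.exp (-(ρ * t)) ≤ Real.exp (-(σ * t)) :=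
  Real.exp_le_exp.2 (by nlinarith)

/-! ## §1  Line 3ᵀ discharged -/

section Line3

open Classical in
/-- **THE RIGHT-FACTOR ENTRIES AT k LEVELS — LINE 3ᵀ DISCHARGED TOO** (p22's `line3_cube_transpose`, consumed at `σ ≤ min σ₀ (ρ₃/2)`): for every right
factor `D′` and input weight `P ≥ 0`, the displayed FIRST LEGS `h_□G_□h_□D′ ≤ 1_{Q_□}(y)·C_L·e^{−2σd}·P(y′)` give
`HasMajorant (G·D′) (A·e^{−(1−α)σ d(y,y′)}·P(y′))` above one threshold — the (2.141)-walk from the right, complete but for its first legs.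
[cite: Balaban1984PropagatorsII, Prop. 2.6 (2.136) p.247, (2.141) p.247, (2.92) p.239 (line 3), (2.133)–(2.135) p.247] -/
theorem prop26_2136T_kLevel_line3_le (d ℓ : ℕ) (hd : 1 ≤ d + 1) (hL : Odd (ℓ + 1) ∧ 1 < ℓ + 1) {b₀ b₁ : ℝ} (hb₀ : 0 < b₀) (hb₁ : b₀ ≤ b₁) :
    ∃ σ₀ : ℝ, 0 < σ₀ ∧ ∀ (σ : ℝ), 0 < σ → σ ≤ σ₀ → ∀ (α : ℝ), 0 ≤ α → α ≤ 1 → ∀ (N₀ : ℕ), 0 < N₀ → ∀ {CL : ℝ}, 0 ≤ CL →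
    ∃ A M₁ : ℝ, 0 ≤ A ∧ 0 < M₁ ∧
    ∀ (m K : ℕ) {Mh k R : ℕ} {P' : Fin (d + 1) → ℕ}
      (hN : ∀ μ, N0 ℓ Mh k P' μ = (PV d ℓ m K hd hL).sitesPerDir 0) (D : TDomains d ℓ Mh k P' R) (hk : k ≤ m + K) (_ : 2 ≤ k)
      {a : ℕ} (hMha : Mh = (ℓ + 1) ^ a) (hM8 : 8 ≤ Mh) (_ : 2 * (ℓ + 1) ^ 2 ≤ R) (hP5 : ∀ μ, 5 ≤ P' μ) (_ : 4 ≤ ℓ)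
      (hpl : ∀ c : ↥(cubes D.toDomains), Placed ℓ k P' c.1)
      (_ : M₁ ≤ ((ℓ : ℝ) + 1) * Mh) (_ : N₀ + 1 ≤ R * ((ℓ + 1) * Mh))
      (_ : Real.exp (-(α * σ)) * ((ℓ : ℝ) + 1) ^ ((2 * (d + 1 : ℕ) : ℝ) / N₀) < 1)
      {cf : ℝ} (hcf : cf ≠ 0) {w : BondIdx (domT hN D hk) → ℝ} (hw : ∀ i, 0 < w i) (_ : GlobalBand b₀ b₁ cf w)
      (D' : Module.End ℝ (PBond (PV d ℓ m K hd hL) 0 → ℝ)) (Pw : (geomT D).Site → ℝ) (_ : ∀ y, 0 ≤ Pw y)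
      (_ : ∀ c : ↥(cubes D.toDomains), HasMajorant (g := geomT D) (blkV1 hN D)
        (mulOp (hB hN D c) * Gl hN hk (one_le_of_eight_le hM8) (four_le_of_five_le hP5) hMha c (band_le (d := d) (ℓ := ℓ) hb₀ hb₁) (hpl c) w cf *
          mulOp (hB hN D c) * D')
        (fun y y' => ind (ST D (one_le_of_eight_le hM8) (four_le_of_five_le hP5) c) y * (CL * Real.exp (-((2 * σ) * (geomT D).dist y y')) * Pw y'))),
      HasMajorant (g := geomT D) (blkV1 hN D) (onFun (GE (domT hN D hk) hcf hw) * D')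
        (fun y y' => A * Real.exp (-((1 - α) * σ * (geomT D).dist y y')) * Pw y') := by
  obtain ⟨σ₀, hσ₀, h⟩ := prop26_2136T_kLevel_final_le d ℓ hd hL hb₀ hb₁
  obtain ⟨ρ₃, CD, cD, M₃, hρ₃, hCD, hcD, h3⟩ := line3_cube_transpose d ℓ hd hL hb₀ hb₁
  refine ⟨min σ₀ (ρ₃ / 2), lt_min hσ₀ (by positivity), fun σ hσ0 hσle α hα0 hα1 N₀ hN₀ CL hCL => ?_⟩
  obtain ⟨A, M₁, hA, hM₁, h2⟩ := h σ hσ0 (hσle.trans (min_le_left _ _)) α hα0 hα1 N₀ hN₀ hCD hcD hCL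
  refine ⟨A, max M₁ M₃, hA, lt_max_of_lt_left hM₁, ?_⟩
  intro m K Mh k R P' hN D hk hk2 a hMha hM8 hR2 hP5 hℓ hpl hLM hRM hθ cf hcf w hw hwb D' Pw hPw hleg
  have h2σ : 2 * σ ≤ ρ₃ := by linarith [hσle.trans (min_le_right _ _)]
  refine h2 m K hN D hk hk2 hMha hM8 hR2 hP5 hℓ hpl ((le_max_left _ _).trans hLM) hRM hθ hcf hw hwb (fun c => ?_) D' Pw hPw hleg
  refine hasMajorant_mono _ (h3 m K hN D hk hk2 hMha hM8 hR2 hP5 hℓ hpl ((le_max_right _ _).trans hLM) hcf w c) fun y y'' => ?_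
  have hl := lenTB_pos (D := D) y
  have hpos : 0 ≤ CD * cf ^ 2 * Real.exp (-(cD * (geomTB D).M)) / (geomTB D).len y ^ 2 := by positivity
  exact mul_le_mul_of_nonneg_left (exp_le_exp_of_rate h2σ (distT_nonneg y y'')) hpos


end Line3

/-! ## §2  The level-gap transport of the prefactor to the output block -/

section Transport

variable {D : TDomains d ℓ Mh k P' R}

/-- **`L^{j(y′)} ≤ L·e^{(τ/2)d_T(y,y′)}·L^{j(y)}`** whenever `2 log L ≤ τ·(R·L·M_h − 1)` (`τ ≥ 0`): the square root of p22's `powL_sq_le_of_levelGap`.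
[cite: Balaban1984PropagatorsII, (2.136) p.247 (the prefactor `Lʲη` of the OUTPUT block), (2.46) p.231; derivation ours] -/
theorem len_le_of_levelGap (D : TDomains d ℓ Mh k P' R) (hMh : 1 ≤ Mh) (hP : ∀ μ, 1 ≤ P' μ) {τ : ℝ} (hτ : 0 ≤ τ)
    (habs : 2 * Real.log ((ℓ : ℝ) + 1) ≤ τ * (((R * ((ℓ + 1) * Mh) - 1 : ℕ)) : ℝ)) (y y' : (geomT D).Site) :
    (geomTB D).len y' ≤ ((ℓ : ℝ) + 1) * Real.exp (τ / 2 * (geomT D).dist y y') * (geomTB D).len y := by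
  rw [geomTB_len, geomTB_len, mul_one, mul_one]
  have h2 := powL_sq_le_of_levelGap D hMh hP hτ habs y y'
  have hL0 : (0 : ℝ) ≤ (ℓ : ℝ) + 1 := by positivity
  have hrhs : 0 ≤ ((ℓ : ℝ) + 1) * Real.exp (τ / 2 * (geomT D).dist y y') * ((ℓ : ℝ) + 1) ^ y.1.1 := by positivity
  have hsq : (((ℓ : ℝ) + 1) * Real.exp (τ / 2 * (geomT D).dist y y') * ((ℓ : ℝ) + 1) ^ y.1.1) ^ 2 =
      ((ℓ : ℝ) + 1) ^ 2 * Real.exp (τ * (geomT D).dist y y') * (((ℓ : ℝ) + 1) ^ y.1.1) ^ 2 := by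
    rw [mul_pow, mul_pow, sq (Real.exp _), ← Real.exp_add]
    ring_nf
  rw [← hsq] at h2
  exact (pow_le_pow_iff_left₀ (pow_nonneg hL0 _) hrhs two_ne_zero).1 h2

/-- **TRANSPORT OF AN INPUT-BLOCK PREFACTOR TO THE OUTPUT BLOCK**: a majorant `A·e^{−ρd(y,y′)}·(L^{j(y′)}·w)` is a majorant
`A·L·(L^{j(y)}·w)·e^{−(ρ−τ/2)d(y,y′)}` (`w ≥ 0`, `2 log L ≤ τ(R·L·M_h − 1)`). [cite: Balaban1984PropagatorsII, (2.136) p.247; derivation ours] -/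
theorem hasMajorant_len_transport (hN : ∀ μ, N0 ℓ Mh k P' μ = (PV d ℓ m K hd hL).sitesPerDir 0) (hMh : 1 ≤ Mh) (hP : ∀ μ, 1 ≤ P' μ)
    {τ : ℝ} (hτ : 0 ≤ τ) (habs : 2 * Real.log ((ℓ : ℝ) + 1) ≤ τ * (((R * ((ℓ + 1) * Mh) - 1 : ℕ)) : ℝ))
    {T : Module.End ℝ (PBond (PV d ℓ m K hd hL) 0 → ℝ)} {A ρ wt : ℝ} (hA : 0 ≤ A) (hwt : 0 ≤ wt)
    (h : HasMajorant (g := geomT D) (blkV1 hN D) T (fun y y' => A * Real.exp (-(ρ * (geomT D).dist y y')) * ((geomTB D).len y' * wt))) :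
    HasMajorant (g := geomT D) (blkV1 hN D) T
      (fun y y' => A * ((ℓ : ℝ) + 1) * ((geomTB D).len y * wt) * Real.exp (-((ρ - τ / 2) * (geomT D).dist y y'))) := by
  refine hasMajorant_mono _ h fun y y' => ?_
  have hl := len_le_of_levelGap D hMh hP hτ habs y y'
  have hE := Real.exp_nonneg (-(ρ * (geomT D).dist y y'))
  have hly := (lenTB_pos (D := D) y).le
  calc A * Real.exp (-(ρ * (geomT D).dist y y')) * ((geomTB D).len y' * wt)
      ≤ A * Real.exp (-(ρ * (geomT D).dist y y')) * ((((ℓ : ℝ) + 1) * Real.exp (τ / 2 * (geomT D).dist y y') * (geomTB D).len y) * wt) :=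
        mul_le_mul_of_nonneg_left (mul_le_mul_of_nonneg_right hl hwt) (mul_nonneg hA hE)
    _ = A * ((ℓ : ℝ) + 1) * ((geomTB D).len y * wt) * (Real.exp (-(ρ * (geomT D).dist y y')) * Real.exp (τ / 2 * (geomT D).dist y y')) := by ring
    _ = A * ((ℓ : ℝ) + 1) * ((geomTB D).len y * wt) * Real.exp (-((ρ - τ / 2) * (geomT D).dist y y')) := by
        rw [← Real.exp_add]; congr 1; ring_nf

/-- **TRANSPORT OF AN OUTPUT-BLOCK PREFACTOR TO THE INPUT BLOCK** (the form the first legs are proved in ↦ the form the left chain consumes):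
`I(y)·(C·(L^{j(y)}·w)·e^{−ρd(y,y′)}) ≤ I(y)·(C·L·e^{−(ρ−τ/2)d(y,y′)}·(L^{j(y′)}·w))` (`I, C, w ≥ 0`, `2 log L ≤ τ(R·L·M_h − 1)`).
[cite: Balaban1984PropagatorsII, (2.136) p.247, (2.141) p.247; derivation ours] -/
theorem hasMajorant_len_transport_in (hN : ∀ μ, N0 ℓ Mh k P' μ = (PV d ℓ m K hd hL).sitesPerDir 0) (hMh : 1 ≤ Mh) (hP : ∀ μ, 1 ≤ P' μ)
    {τ : ℝ} (hτ : 0 ≤ τ) (habs : 2 * Real.log ((ℓ : ℝ) + 1) ≤ τ * (((R * ((ℓ + 1) * Mh) - 1 : ℕ)) : ℝ))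
    {T : Module.End ℝ (PBond (PV d ℓ m K hd hL) 0 → ℝ)} {I : (geomT D).Site → ℝ} {C ρ wt : ℝ} (hI : ∀ y, 0 ≤ I y) (hC : 0 ≤ C) (hwt : 0 ≤ wt)
    (h : HasMajorant (g := geomT D) (blkV1 hN D) T (fun y y' => I y * (C * ((geomTB D).len y * wt) * Real.exp (-(ρ * (geomT D).dist y y'))))) :
    HasMajorant (g := geomT D) (blkV1 hN D) T
      (fun y y' => I y * (C * ((ℓ : ℝ) + 1) * Real.exp (-((ρ - τ / 2) * (geomT D).dist y y')) * ((geomTB D).len y' * wt))) := by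
  refine hasMajorant_mono _ h fun y y' => mul_le_mul_of_nonneg_left ?_ (hI y)
  have hl := len_le_of_levelGap D hMh hP hτ habs y' y
  rw [symmT D y' y] at hl
  have hE := Real.exp_nonneg (-(ρ * (geomT D).dist y y'))
  calc C * ((geomTB D).len y * wt) * Real.exp (-(ρ * (geomT D).dist y y'))
      ≤ C * ((((ℓ : ℝ) + 1) * Real.exp (τ / 2 * (geomT D).dist y y') * (geomTB D).len y') * wt) * Real.exp (-(ρ * (geomT D).dist y y')) :=
        mul_le_mul_of_nonneg_right (mul_le_mul_of_nonneg_left (mul_le_mul_of_nonneg_right hl hwt) hC) hE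
    _ = C * ((ℓ : ℝ) + 1) * (Real.exp (-(ρ * (geomT D).dist y y')) * Real.exp (τ / 2 * (geomT D).dist y y')) * ((geomTB D).len y' * wt) := by ring
    _ = C * ((ℓ : ℝ) + 1) * Real.exp (-((ρ - τ / 2) * (geomT D).dist y y')) * ((geomTB D).len y' * wt) := by
        rw [← Real.exp_add]; congr 2; ring_nf

end Transport

/-! ## §3  (2.136)₃: `|(G∇*_νJ)(x)| ≤ O(1)·L^{j(y)}|c′|⁻¹·e^{−δd(y,y′)}|J|` from the first legs -/

section Div

open Classical in
/-- **PROPOSITION 2.6 (2.136)₃ AT k LEVELS FOR THE GENUINE G, FROM ITS FIRST LEGS.**  For the genuine `(k+1)`-level torus family (`L ≥ 5`, `M_h = L^a ≥ 8`,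
`R ≥ 2L²`, `P′ ≥ 5`, every cube placed, global band): there is `σ₀ > 0` such that for all `σ ∈ (0, σ₀]`, `α ∈ [0,1]`, `N₀ > 0`, `C_L ≥ 0`, `τ ≥ 0` there
are `A, M₁` with: on every torus above threshold with the Lemma-2.1 budget, `2 log L ≤ τ(R·L·M_h − 1)`, and the displayed FIRST LEGS
`HasMajorant (h_□G_□h_□·∇^{η*}_ν) (1_{Q_□}(y)·C_L·e^{−2σd(y,y′)}·L^{j(y′)}/|c′|)` for every cube,
`HasMajorant (G·∇^{η*}_ν) (A·(L^{j(y)}/|c′|)·e^{−((1−α)σ − τ/2)d(y,y′)})` — print's `|(G∇*J)(x)| ≤ O(1)Lʲη e^{−δ₃d(y,y′)}|J|`.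
[cite: Balaban1984PropagatorsII, Prop. 2.6 (2.136) p.247 (third entry), (2.141) p.247, (2.133)–(2.135) p.247, (2.92) p.239] -/
theorem prop26_2136_div_kLevel_le (d ℓ : ℕ) (hd : 1 ≤ d + 1) (hL : Odd (ℓ + 1) ∧ 1 < ℓ + 1) {b₀ b₁ : ℝ} (hb₀ : 0 < b₀) (hb₁ : b₀ ≤ b₁) :
    ∃ σ₀ : ℝ, 0 < σ₀ ∧ ∀ (σ : ℝ), 0 < σ → σ ≤ σ₀ → ∀ (α : ℝ), 0 ≤ α → α ≤ 1 → ∀ (N₀ : ℕ), 0 < N₀ → ∀ {CL : ℝ}, 0 ≤ CL → ∀ {τ : ℝ}, 0 ≤ τ →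
    ∃ A M₁ : ℝ, 0 ≤ A ∧ 0 < M₁ ∧
    ∀ (m K : ℕ) {Mh k R : ℕ} {P' : Fin (d + 1) → ℕ}
      (hN : ∀ μ, N0 ℓ Mh k P' μ = (PV d ℓ m K hd hL).sitesPerDir 0) (D : TDomains d ℓ Mh k P' R) (hk : k ≤ m + K) (_ : 2 ≤ k)
      {a : ℕ} (hMha : Mh = (ℓ + 1) ^ a) (hM8 : 8 ≤ Mh) (_ : 2 * (ℓ + 1) ^ 2 ≤ R) (hP5 : ∀ μ, 5 ≤ P' μ) (_ : 4 ≤ ℓ)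
      (hpl : ∀ c : ↥(cubes D.toDomains), Placed ℓ k P' c.1)
      (_ : M₁ ≤ ((ℓ : ℝ) + 1) * Mh) (_ : N₀ + 1 ≤ R * ((ℓ + 1) * Mh))
      (_ : Real.exp (-(α * σ)) * ((ℓ : ℝ) + 1) ^ ((2 * (d + 1 : ℕ) : ℝ) / N₀) < 1)
      (_ : 2 * Real.log ((ℓ : ℝ) + 1) ≤ τ * (((R * ((ℓ + 1) * Mh) - 1 : ℕ)) : ℝ))
      {cf : ℝ} (hcf : cf ≠ 0) {w : BondIdx (domT hN D hk) → ℝ} (hw : ∀ i, 0 < w i) (_ : GlobalBand b₀ b₁ cf w) (ν : Fin (d + 1))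
      (_ : ∀ c : ↥(cubes D.toDomains), HasMajorant (g := geomT D) (blkV1 hN D)
        (mulOp (hB hN D c) * Gl hN hk (one_le_of_eight_le hM8) (four_le_of_five_le hP5) hMha c (band_le (d := d) (ℓ := ℓ) hb₀ hb₁) (hpl c) w cf *
          mulOp (hB hN D c) * DVa ν cf)
        (fun y y' => ind (ST D (one_le_of_eight_le hM8) (four_le_of_five_le hP5) c) y *
          (CL * Real.exp (-((2 * σ) * (geomT D).dist y y')) * ((geomTB D).len y' * |cf|⁻¹)))),
      HasMajorant (g := geomT D) (blkV1 hN D) (onFun (GE (domT hN D hk) hcf hw) * DVa ν cf)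
        (fun y y' => A * ((geomTB D).len y * |cf|⁻¹) * Real.exp (-(((1 - α) * σ - τ / 2) * (geomT D).dist y y'))) := by
  obtain ⟨σ₀, hσ₀, h⟩ := prop26_2136T_kLevel_line3_le d ℓ hd hL hb₀ hb₁
  refine ⟨σ₀, hσ₀, fun σ hσ0 hσle α hα0 hα1 N₀ hN₀ CL hCL τ hτ => ?_⟩
  obtain ⟨A, M₁, hA, hM₁, h2⟩ := h σ hσ0 hσle α hα0 hα1 N₀ hN₀ hCL
  refine ⟨A * ((ℓ : ℝ) + 1), M₁, by positivity, hM₁, ?_⟩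
  intro m K Mh k R P' hN D hk hk2 a hMha hM8 hR2 hP5 hℓ hpl hLM hRM hθ habs cf hcf w hw hwb ν hleg
  have hMh1 : 1 ≤ Mh := one_le_of_eight_le hM8
  have hP : ∀ μ, 1 ≤ P' μ := one_le_of_four_le (four_le_of_five_le hP5)
  have hmain := h2 m K hN D hk hk2 hMha hM8 hR2 hP5 hℓ hpl hLM hRM hθ hcf hw hwb (DVa ν cf) (fun y' => (geomTB D).len y' * |cf|⁻¹)
    (fun y' => mul_nonneg (lenTB_pos (D := D) y').le (inv_nonneg.2 (abs_nonneg _))) hleg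
  exact hasMajorant_len_transport hN hMh1 hP hτ habs hA (inv_nonneg.2 (abs_nonneg _)) hmain

open Classical in
/-- **(2.136)₃ FROM FIRST LEGS IN THE OUTPUT-PREFACTOR FORM** (the shape of gen-30's `hDG0_cube` transposed, p22's `hGDVa0_cube`):
`HasMajorant (h_□G_□h_□∇*_ν) (1_{Q_□}(y)·C_L·(L^{j(y)}/|c′|)·e^{−ρ_L d})` per cube, at any rate `ρ_L > 0` ⇒ for `σ ≤ σ₀ = min σ₀′ (ρ_L/3)` and any transport
budget `τ ∈ [0, 2σ]` chosen AFTER `σ` (e.g. `τ := (1−α)σ`, giving the rate `(1−α)σ/2`), above one threshold,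
`HasMajorant (G∇*_ν) (A·(L^{j(y)}/|c′|)·e^{−((1−α)σ − τ/2)d(y,y′)})`. [cite: Balaban1984PropagatorsII, Prop. 2.6 (2.136) p.247 (third entry), (2.141) p.247] -/
theorem prop26_2136_div_kLevel_of_outLeg (d ℓ : ℕ) (hd : 1 ≤ d + 1) (hL : Odd (ℓ + 1) ∧ 1 < ℓ + 1) {b₀ b₁ : ℝ} (hb₀ : 0 < b₀) (hb₁ : b₀ ≤ b₁)
    {ρL : ℝ} (hρL : 0 < ρL) :
    ∃ σ₀ : ℝ, 0 < σ₀ ∧ ∀ (σ : ℝ), 0 < σ → σ ≤ σ₀ → ∀ (α : ℝ), 0 ≤ α → α ≤ 1 → ∀ (N₀ : ℕ), 0 < N₀ → ∀ {CL : ℝ}, 0 ≤ CL →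
    ∀ {τ : ℝ}, 0 ≤ τ → τ ≤ 2 * σ →
    ∃ A M₁ : ℝ, 0 ≤ A ∧ 0 < M₁ ∧
    ∀ (m K : ℕ) {Mh k R : ℕ} {P' : Fin (d + 1) → ℕ}
      (hN : ∀ μ, N0 ℓ Mh k P' μ = (PV d ℓ m K hd hL).sitesPerDir 0) (D : TDomains d ℓ Mh k P' R) (hk : k ≤ m + K) (_ : 2 ≤ k)
      {a : ℕ} (hMha : Mh = (ℓ + 1) ^ a) (hM8 : 8 ≤ Mh) (_ : 2 * (ℓ + 1) ^ 2 ≤ R) (hP5 : ∀ μ, 5 ≤ P' μ) (_ : 4 ≤ ℓ)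
      (hpl : ∀ c : ↥(cubes D.toDomains), Placed ℓ k P' c.1)
      (_ : M₁ ≤ ((ℓ : ℝ) + 1) * Mh) (_ : N₀ + 1 ≤ R * ((ℓ + 1) * Mh))
      (_ : Real.exp (-(α * σ)) * ((ℓ : ℝ) + 1) ^ ((2 * (d + 1 : ℕ) : ℝ) / N₀) < 1)
      (_ : 2 * Real.log ((ℓ : ℝ) + 1) ≤ τ * (((R * ((ℓ + 1) * Mh) - 1 : ℕ)) : ℝ))
      {cf : ℝ} (hcf : cf ≠ 0) {w : BondIdx (domT hN D hk) → ℝ} (hw : ∀ i, 0 < w i) (_ : GlobalBand b₀ b₁ cf w) (ν : Fin (d + 1))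
      (_ : ∀ c : ↥(cubes D.toDomains), HasMajorant (g := geomT D) (blkV1 hN D)
        (mulOp (hB hN D c) * Gl hN hk (one_le_of_eight_le hM8) (four_le_of_five_le hP5) hMha c (band_le (d := d) (ℓ := ℓ) hb₀ hb₁) (hpl c) w cf *
          mulOp (hB hN D c) * DVa ν cf)
        (fun y y' => ind (ST D (one_le_of_eight_le hM8) (four_le_of_five_le hP5) c) y *
          (CL * ((geomTB D).len y * |cf|⁻¹) * Real.exp (-(ρL * (geomT D).dist y y'))))),
      HasMajorant (g := geomT D) (blkV1 hN D) (onFun (GE (domT hN D hk) hcf hw) * DVa ν cf)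
        (fun y y' => A * ((geomTB D).len y * |cf|⁻¹) * Real.exp (-(((1 - α) * σ - τ / 2) * (geomT D).dist y y'))) := by
  obtain ⟨σ₀, hσ₀, h⟩ := prop26_2136_div_kLevel_le d ℓ hd hL hb₀ hb₁
  have hρ' : 0 < ρL / 3 := by positivity
  refine ⟨min σ₀ (ρL / 3), lt_min hσ₀ hρ', fun σ hσ0 hσle α hα0 hα1 N₀ hN₀ CL hCL τ hτ hτσ => ?_⟩
  have hCL' : 0 ≤ CL * ((ℓ : ℝ) + 1) := by positivity
  obtain ⟨A, M₁, hA, hM₁, h2⟩ := h σ hσ0 (hσle.trans (min_le_left _ _)) α hα0 hα1 N₀ hN₀ hCL' (τ := τ) hτ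
  refine ⟨A, M₁, hA, hM₁, ?_⟩
  intro m K Mh k R P' hN D hk hk2 a hMha hM8 hR2 hP5 hℓ hpl hLM hRM hθ habs cf hcf w hw hwb ν hleg
  have hMh1 : 1 ≤ Mh := one_le_of_eight_le hM8
  have hP : ∀ μ, 1 ≤ P' μ := one_le_of_four_le (four_le_of_five_le hP5)
  have h2σ : 2 * σ ≤ ρL - τ / 2 := by linarith [hσle.trans (min_le_right _ _)]
  refine h2 m K hN D hk hk2 hMha hM8 hR2 hP5 hℓ hpl hLM hRM hθ habs hcf hw hwb ν fun c => ?_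
  have hx := hasMajorant_len_transport_in hN hMh1 hP hτ habs (fun y => B6Prop26Gluing.ind_nonneg _ y) hCL (inv_nonneg.2 (abs_nonneg cf)) (hleg c)
  refine hasMajorant_mono _ hx fun y y' => mul_le_mul_of_nonneg_left ?_ (B6Prop26Gluing.ind_nonneg _ y)
  have hlen : 0 ≤ (geomTB D).len y' * |cf|⁻¹ := mul_nonneg (lenTB_pos (D := D) y').le (inv_nonneg.2 (abs_nonneg _))
  exact mul_le_mul_of_nonneg_right (mul_le_mul_of_nonneg_left (exp_le_exp_of_rate h2σ (distT_nonneg y y')) hCL') hlen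

open Classical in
/-- **PROPOSITION 2.6 (2.136)₃ AT k LEVELS FOR THE GENUINE G — NO DISPLAYED LEG** (the first legs discharged by p38's `hGDVa0_cube`,
`…B6GDVaLegKLevelV1`): there is `σ₀ > 0` such that for all `σ ∈ (0, σ₀]`, `α ∈ [0,1]`, `N₀ > 0` and every transport budget `τ ∈ [0, 2σ]` (chosen
AFTER `σ`; `τ := (1−α)σ` gives the rate `(1−α)σ/2`) there are `A, M₁` such that on every admissible torus above threshold (Lemma-2.1 budget,
`2 log L ≤ τ(R·L·M_h − 1)`), for every `c′ ≠ 0`, positive weights in the global band and every direction `ν`,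
`HasMajorant (G·∇^{η*}_ν) (A·(L^{j(y)}/|c′|)·e^{−((1−α)σ − τ/2)d_T(y,y′)})` — print's `|(G∇*J)(x)| ≤ O(1)Lʲη e^{−δ₃d(y,y′)}|J|`, `x ∈ B^j(y)`, `J ∈ A(B(y′))`.
[cite: Balaban1984PropagatorsII, Prop. 2.6 (2.136) p.247 (third entry), (2.141) p.247, (2.133)–(2.135) p.247, (2.88)–(2.94) pp.238–239, Lemma 2.1 p.234] -/
theorem prop26_2136_div_kLevel (d ℓ : ℕ) (hd : 1 ≤ d + 1) (hL : Odd (ℓ + 1) ∧ 1 < ℓ + 1) {b₀ b₁ : ℝ} (hb₀ : 0 < b₀) (hb₁ : b₀ ≤ b₁) :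
    ∃ σ₀ : ℝ, 0 < σ₀ ∧ ∀ (σ : ℝ), 0 < σ → σ ≤ σ₀ → ∀ (α : ℝ), 0 ≤ α → α ≤ 1 → ∀ (N₀ : ℕ), 0 < N₀ → ∀ {τ : ℝ}, 0 ≤ τ → τ ≤ 2 * σ →
    ∃ A M₁ : ℝ, 0 ≤ A ∧ 0 < M₁ ∧
    ∀ (m K : ℕ) {Mh k R : ℕ} {P' : Fin (d + 1) → ℕ}
      (hN : ∀ μ, N0 ℓ Mh k P' μ = (PV d ℓ m K hd hL).sitesPerDir 0) (D : TDomains d ℓ Mh k P' R) (hk : k ≤ m + K) (_ : 2 ≤ k)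
      {a : ℕ} (_ : Mh = (ℓ + 1) ^ a) (_ : 8 ≤ Mh) (_ : 2 * (ℓ + 1) ^ 2 ≤ R) (_ : ∀ μ, 5 ≤ P' μ) (_ : 4 ≤ ℓ)
      (_ : ∀ c : ↥(cubes D.toDomains), Placed ℓ k P' c.1)
      (_ : M₁ ≤ ((ℓ : ℝ) + 1) * Mh) (_ : N₀ + 1 ≤ R * ((ℓ + 1) * Mh))
      (_ : Real.exp (-(α * σ)) * ((ℓ : ℝ) + 1) ^ ((2 * (d + 1 : ℕ) : ℝ) / N₀) < 1)
      (_ : 2 * Real.log ((ℓ : ℝ) + 1) ≤ τ * (((R * ((ℓ + 1) * Mh) - 1 : ℕ)) : ℝ))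
      {cf : ℝ} (hcf : cf ≠ 0) {w : BondIdx (domT hN D hk) → ℝ} (hw : ∀ i, 0 < w i) (_ : GlobalBand b₀ b₁ cf w) (ν : Fin (d + 1)),
      HasMajorant (g := geomT D) (blkV1 hN D) (onFun (GE (domT hN D hk) hcf hw) * DVa ν cf)
        (fun y y' => A * ((geomTB D).len y * |cf|⁻¹) * Real.exp (-(((1 - α) * σ - τ / 2) * (geomT D).dist y y'))) := by
  have ha₀ : (0 : ℝ) < b₀ / ((ℓ + 1 : ℕ) : ℝ) := by positivity
  obtain ⟨ρD, hρD, CD, hCD, hlegs⟩ := hGDVa0_cube d ℓ hd hL ha₀ (band_le (d := d) (ℓ := ℓ) hb₀ hb₁)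
  obtain ⟨σ₀, hσ₀, h⟩ := prop26_2136_div_kLevel_of_outLeg d ℓ hd hL hb₀ hb₁ hρD
  refine ⟨σ₀, hσ₀, fun σ hσ0 hσle α hα0 hα1 N₀ hN₀ τ hτ hτσ => ?_⟩
  obtain ⟨A, M₁, hA, hM₁, h2⟩ := h σ hσ0 hσle α hα0 hα1 N₀ hN₀ hCD hτ hτσ
  refine ⟨A, M₁, hA, hM₁, ?_⟩
  intro m K Mh k R P' hN D hk hk2 a hMha hM8 hR2 hP5 hℓ hpl hLM hRM hθ habs cf hcf w hw hwb ν
  refine h2 m K hN D hk hk2 hMha hM8 hR2 hP5 hℓ hpl hLM hRM hθ habs hcf hw hwb ν fun c => ?_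
  have hx := hlegs m K hN D hk (one_le_of_eight_le hM8) (four_le_of_five_le hP5) hMha hM8 hR2 hP5 hℓ c (hpl c) w hcf ν
  refine hasMajorant_mono _ hx fun y y' => le_of_eq ?_
  rw [geomTB_len, B8Ineq192MultiLevelTorus.geomT_len]

end Div

/-! ## §5  (2.136)₃ in the census shape: one rate, one constant, thresholds chosen once (gen 34) -/

section Census

/-- the budget inequality `e^{−ασ}·L^{2(d+1)/N₀} < 1` for `N₀ := ⌈2(d+1)·log L/(ασ)⌉₊ + 1` (`α, σ > 0`); the private helper of
`…B6Prop26LapKLevelV1`, re-proved. [folklore] -/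
private theorem budget_lt_one {d ℓ : ℕ} {α σ : ℝ} (hα : 0 < α) (hσ : 0 < σ) :
    Real.exp (-(α * σ)) * ((ℓ : ℝ) + 1) ^ ((2 * (d + 1 : ℕ) : ℝ) / (⌈2 * ((d : ℝ) + 1) * Real.log ((ℓ : ℝ) + 1) / (α * σ)⌉₊ + 1 : ℕ)) < 1 := by
  have hL : (0 : ℝ) < (ℓ : ℝ) + 1 := by positivity
  have hlog : 0 ≤ Real.log ((ℓ : ℝ) + 1) := Real.log_nonneg (by linarith [(Nat.cast_nonneg ℓ : (0 : ℝ) ≤ ℓ)])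
  have hN : 2 * ((d : ℝ) + 1) * Real.log ((ℓ : ℝ) + 1) / (α * σ) <
      ((⌈2 * ((d : ℝ) + 1) * Real.log ((ℓ : ℝ) + 1) / (α * σ)⌉₊ + 1 : ℕ) : ℝ) := by
    push_cast
    exact lt_of_le_of_lt (Nat.le_ceil _) (lt_add_one _)
  have hNpos : (0 : ℝ) < ((⌈2 * ((d : ℝ) + 1) * Real.log ((ℓ : ℝ) + 1) / (α * σ)⌉₊ + 1 : ℕ) : ℝ) := by positivity
  have hασ : 0 < α * σ := mul_pos hα hσ
  have key : (2 * (d + 1 : ℕ) : ℝ) / (⌈2 * ((d : ℝ) + 1) * Real.log ((ℓ : ℝ) + 1) / (α * σ)⌉₊ + 1 : ℕ) * Real.log ((ℓ : ℝ) + 1) < α * σ := by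
    rw [div_mul_eq_mul_div, div_lt_iff₀ hNpos]
    rw [div_lt_iff₀ hασ] at hN
    push_cast at hN ⊢
    nlinarith
  rw [Real.rpow_def_of_pos hL, ← Real.exp_add, Real.exp_lt_one_iff]
  nlinarith

/-- the transport condition `2 log L ≤ τ·(R·L·M_h − 1)` from `⌈2 log L/τ⌉₊ ≤ N` and `N + 1 ≤ R·L·M_h` (`τ > 0`). [folklore] -/
private theorem transport_of_le {ℓ Mh R N : ℕ} {τ : ℝ} (hτ : 0 < τ) (hN : ⌈2 * Real.log ((ℓ : ℝ) + 1) / τ⌉₊ ≤ N)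
    (hRM : N + 1 ≤ R * ((ℓ + 1) * Mh)) : 2 * Real.log ((ℓ : ℝ) + 1) ≤ τ * (((R * ((ℓ + 1) * Mh) - 1 : ℕ)) : ℝ) := by
  have h1 : 2 * Real.log ((ℓ : ℝ) + 1) / τ ≤ (N : ℝ) := (Nat.le_ceil _).trans (by exact_mod_cast hN)
  have h2 : (N : ℝ) ≤ (((R * ((ℓ + 1) * Mh) - 1 : ℕ)) : ℝ) := by exact_mod_cast (by omega : N ≤ R * ((ℓ + 1) * Mh) - 1)
  rw [div_le_iff₀ hτ] at h1
  nlinarith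

open Classical in
/-- **PROPOSITION 2.6 (2.136)₃ AT k LEVELS FOR THE GENUINE `G`, CENSUS SHAPE** — ONE rate `δ > 0`, ONE constant `A` and the torus-size thresholds
`M₂`, `N₁` chosen ONCE for the weight band (the shape the k-level census of `B6.Prop26Printed` consumes, fold owner r03 g26): on every admissible V1
torus (`k ≥ 2`, `M_h = Lᵃ ≥ 8`, `R ≥ 2L²`, `P′ ≥ 5`, `L ≥ 5`, cubes placed) with `M₂ ≤ L·M_h` and `N₁ + 1 ≤ R·L·M_h`, for every `c′ ≠ 0`, positive weights in
the global band and every direction `ν`: `HasMajorant (G ∘ ∇^{η*}_ν) (A·(L^{j(y)}|c′|⁻¹)·e^{−δ d_T(y,y′)})` — print's `|(G∇*J)(x)| ≤ O(1)Lʲη e^{−δ₃d(y,y′)}|J|`,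
`x ∈ B^j(y)`, `J ∈ A(B(y′))`.  By instantiation of `prop26_2136_div_kLevel` at `σ := σ₀`, Lemma-2.1 exponent `½`, transport budget `τ := σ₀/2`
(rate `δ = σ₀/4`), the two side conditions discharged by `N₁ := max (⌈2(d+1)log L/(σ₀/2)⌉₊ + 1) ⌈2 log L/(σ₀/2)⌉₊`.
[cite: Balaban1984PropagatorsII, Prop. 2.6 (2.136) p.247 (third entry), (2.141) p.247, (2.133)–(2.135) p.247, (2.88)–(2.94) pp.238–239, Lemma 2.1 p.234] -/
theorem prop26_2136_div_kLevel_census (d ℓ : ℕ) (hd : 1 ≤ d + 1) (hL : Odd (ℓ + 1) ∧ 1 < ℓ + 1) {b₀ b₁ : ℝ} (hb₀ : 0 < b₀) (hb₁ : b₀ ≤ b₁) :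
    ∃ (δ A M₂ : ℝ) (N₁ : ℕ), 0 < δ ∧ 0 ≤ A ∧ 0 < M₂ ∧
      ∀ (m K : ℕ) {Mh k R : ℕ} {P' : Fin (d + 1) → ℕ}
        (hN : ∀ μ, N0 ℓ Mh k P' μ = (PV d ℓ m K hd hL).sitesPerDir 0) (D : TDomains d ℓ Mh k P' R) (hk : k ≤ m + K) (_ : 2 ≤ k)
        {a : ℕ} (_ : Mh = (ℓ + 1) ^ a) (_ : 8 ≤ Mh) (_ : 2 * (ℓ + 1) ^ 2 ≤ R) (_ : ∀ μ, 5 ≤ P' μ) (_ : 4 ≤ ℓ)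
        (_ : ∀ c : ↥(cubes D.toDomains), Placed ℓ k P' c.1) (_ : M₂ ≤ ((ℓ : ℝ) + 1) * Mh) (_ : N₁ + 1 ≤ R * ((ℓ + 1) * Mh))
        {cf : ℝ} (hcf : cf ≠ 0) {w : BondIdx (domT hN D hk) → ℝ} (hw : ∀ i, 0 < w i) (_ : GlobalBand b₀ b₁ cf w) (ν : Fin (d + 1)),
        HasMajorant (g := geomT D) (blkV1 hN D) (onFun (GE (domT hN D hk) hcf hw) ∘ₗ DVa ν cf)
          (fun y y' => A * ((geomT D).len y * |cf|⁻¹) * Real.exp (-(δ * (geomT D).dist y y'))) := by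
  obtain ⟨σ₀, hσ₀, h⟩ := prop26_2136_div_kLevel d ℓ hd hL hb₀ hb₁
  obtain ⟨A, M₁, hA, hM₁, h2⟩ := h σ₀ hσ₀ le_rfl (1 / 2) (by norm_num) (by norm_num)
    (⌈2 * ((d : ℝ) + 1) * Real.log ((ℓ : ℝ) + 1) / (1 / 2 * σ₀)⌉₊ + 1) (Nat.succ_pos _) (τ := σ₀ / 2) (by positivity) (by linarith)
  refine ⟨σ₀ / 4, A, M₁, max (⌈2 * ((d : ℝ) + 1) * Real.log ((ℓ : ℝ) + 1) / (1 / 2 * σ₀)⌉₊ + 1) ⌈2 * Real.log ((ℓ : ℝ) + 1) / (σ₀ / 2)⌉₊,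
    by positivity, hA, hM₁, ?_⟩
  intro m K Mh k R P' hN D hk hk2 a hMha hM8 hR2 hP5 hℓ hpl hLM hRM cf hcf w hw hwb ν
  have hθ := budget_lt_one (d := d) (ℓ := ℓ) (α := 1 / 2) (σ := σ₀) (by norm_num) hσ₀
  have hRM0 := le_trans (Nat.succ_le_succ (le_max_left _ ⌈2 * Real.log ((ℓ : ℝ) + 1) / (σ₀ / 2)⌉₊)) hRM
  have hτ' := transport_of_le (Mh := Mh) (R := R) (by positivity : (0 : ℝ) < σ₀ / 2) (le_max_right _ _) hRM
  have hx := h2 m K hN D hk hk2 hMha hM8 hR2 hP5 hℓ hpl hLM hRM0 hθ hτ' hcf hw hwb ν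
  show HasMajorant (g := geomT D) (blkV1 hN D) (onFun (GE (domT hN D hk) hcf hw) * DVa ν cf) _
  refine hasMajorant_mono _ hx fun y y' => le_of_eq ?_
  rw [show ((1 : ℝ) - 1 / 2) * σ₀ - σ₀ / 2 / 2 = σ₀ / 4 by ring]
  rfl

end Census

end Literature.MathematicalPhysics.QuantumFieldTheory.Balaban1983to89.B6Prop26DivLegKLevelV1

end
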